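import Summits.QuantumFields.BalabanUV.Beta.CompositeCorrectorLinear
import Summits.QuantumFields.BalabanUV.Beta.AxialDressingRootedSupport

/-!
# `BalabanUV.Beta.CompositeCorrectorLocality` — binder row D1, work item K-U3d leaf L2 (Form level, part 2 of 2): **THE (a1*)_m CORRECTORS READ THE
# FIELD ON FINITELY MANY BONDS** — `(Ψ_m A)_α(x)` depends on `A` only through the bond `(α, x)` and the bonds with BOTH endpoints in the `n`-block of
# `x` or of `x + e_α` (`n = L^m`; range `0` in block units)
# (β sub-cell, BINDER-OWNERS row D1; cross-lane idle seat t4-ne9-formalise-leaf-06 gen 32 on the row-D1 OWNER an2-g24's leaf list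
# `HOME/b2b-balaban-beta-an2/gen24/K-U3d-LEAVES.v1.3205b2870f6492d5.md` §L2; over L1 `CompositeCorrectorForms` p241443 BY NAME)

HONEST FRAMING (cell charter, verbatim): «discharging BetaPertH makes Balaban's UV stability UNCONDITIONAL — a real
constructive-QFT result; it is NOT the continuum limit and NOT the Clay problem.»
HONEST DEPENDENCY: continuum YM on T⁴ ⇐ BetaPertH ∧ nine spine estimates (0/9 proved); BetaPertH ⇐ (D1) ∧ (D4) ∧ CAP+tail;
G-an2-4 gates asym, D1 and NE2/3/4.
ABSOLUTE RULE (cell, verbatim): «No internally-minted statement may enter as a cited fact. Every hypothesis is either kernel-proved in this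
package or a verbatim quotation of a PUBLISHED theorem with page reference. The manuscript(s) under audit are NOT citable for their own
disputed steps — they are the thing under adjudication; programme-internal (2001/route/tribunal) claims are never citable.»
NOTHING below is cited: no `[cite: …]`, no `Prop` fact.  [our object] READ SETS (`Set`-valued bookkeeping definitions `InBlockBond`, `InPair`, `InPairBond`,
`CorrReads` — WHICH bonds a functional reads — and the `Prop`-structure `DepOn`) and [folklore] finite-sum algebra over the cell's OWN typed objects BY NAME:
an1's `AveragingContours.axial ∕ segUp ∕ rev ∕ blk` and `AveragingContoursRooted.linAvgAt ∕ treeGaugeAt ∕ gammaCAt` (`linAvgAt_sub`), the an2 lineage's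
letter-site lemmas `AxialDressingRooted.InHull ∕ mem_axial_hull ∕ mem_segUp_site`, an3-g37's `CompositeAveragingCoarseExact.compLinAvgAt ∕ compDefectAt`
(`_succ` clauses), the row-D1 owner's L1 `CompositeCorrectorForms.corrPhi ∕ corrPsi` (`treeGaugeAt_sub`), and part 1 `CompositeCorrectorLinear`
(`corrPsi_apply ∕ corrPhi_apply`).  It asserts nothing about Bałaban's non-linear averages beyond their typed linearisations.

WHY (K-U3d leaf L2, the APPLY BRIDGE «no hypothesis on K»).  The kernelised corrector `Ψ̂` of `CompositeCorrectorKernel` acts on a column of an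
ARBITRARY kernel `K` through `comp`, whose middle sum is a `tsum` over `ℤ^{d}`; that this `tsum` is a finite sum and equals `Ψ_m` applied to the
column needs `A ↦ (Ψ_m A)_α(x)` ℝ-linear (part 1) and READING ONLY FINITELY MANY BONDS (this file).  The read set is closed-form (§3): the bond
itself and the intra-block bonds of the two `n`-blocks met by the bond `(α, x)` (an3-g39's pointer (R5), journal l.23703: range `0` in block
units under the in-block-root binder) — so the finite-range statement of the leaf list (`psiK_eq_idK_of_far`) comes with range `0`.

WHAT (`d` the lattice dimension; `L` the block side, `k`/`m` levels, `n = L^m`; roots `r : ℕ → (Fin d → ℕ)` IN THEIR BLOCKS `hr : ∀ k, r k ∈ box d L`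
— REFEREE #31 I-d1ref31-2: never weakened; all [folklore]):
§1 [our object] `DepOn P f` («the functional `f` of the field reads only the bonds of `P`») + calculus: `mono`, `depOn_const`, `depOn_eval`, `add`, `sub`,
   `mul_left`, `depOn_sum`, COMPOSITION `DepOn.comp` with a field operator.
§2 ONE LEVEL (block side `N ≥ 1`, in-block root): floor-division letters `le_of_blk ∕ lt_of_blk ∕ blk_apply_eq_of_bounds ∕ blk_one ∕ blk_pow_succ' ∕ blk_apply_mono`,
   THE HULL LEMMA `blk_eq_of_inHull`; [our object] `InBlockBond` (`mem_inBlockBond`), `InPair`, `InPairBond` (+ `inPair_of_blk_eq ∕ _add`, `inPair_seg`, `mem_rev`);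
   **`depOn_treeGaugeAt`** (the rooted tree integral at `x` reads only bonds with both endpoints in the `N`-block of `x`), **`depOn_linAvgAt`** (the rooted
   linear average at the coarse bond `(μ, z)` reads only bonds with both endpoints in the block pair `z ≤ blk N · ≤ z + e_μ`).
§3 ALL LEVELS: `inPair_pow_succ`, `blk_pow_succ_eq_of_inPair`; **`depOn_compLinAvgAt`** (the level-`k` composite at the bond `(κ, z)` reads fine bonds with both
   endpoints in the `L^k`-block pair of `z`), **`depOn_compDefectAt`** (`ζ_m A Y` reads only fine bonds with BOTH endpoints in the `L^m`-block `Y`),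
   [our object] `CorrReads`, **`depOn_corrPsi`**, **`depOn_corrPhi`**.
§4 [our object] `blockSitesF n Y` (the `n`-block `Y` as a `Finset` of sites), `corrDep n α x` (a `Finset` ⊇ `CorrReads n α x`): `mem_blockSitesF_of_blk_eq`,
   `mem_corrDep_of_mem_corrReads` — so every corrector component reads a FINITE set of bonds.
Provenance: β sub-cell; cross-lane idle seat `b2b-balaban-t4-ne9-formalise-leaf-06` gen 32 (prover-b2b-balaban-t4-ne9-formalise-leaf-06-g32-0), 2026-08-21, on the
row-D1 owner's K-U3d leaf list (INTENT journal l.23693, SHAPE l.23754; an3-g39 pointer (R5) l.23703).  NOT (SDF), NOT D1, NOT `BetaPertH`, NOT continuum, NOT Clay.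
-/

namespace Summit.QuantumFields.BalabanUV.Beta.CompositeCorrectorLocality

open Finset
open scoped BigOperators
open Literature.MathematicalPhysics.QuantumFieldTheory.Balaban1983to89.Beta
open AffineAveraging (Site Form0 Form1 box toSite unitVec unitVec_apply blockSum)
open AveragingContours (blk blk_block axial segUp rev)
open AveragingContoursRooted (linAvgAt treeGaugeAt gammaCAt linAvgAt_sub)
open Summit.QuantumFields.BalabanUV.Beta.CompositeAveragingCoarseExact (compLinAvgAt compDefectAt)
open Summit.QuantumFields.BalabanUV.Beta.CompositeCorrectorForms (corrPhi corrPsi treeGaugeAt_sub)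
open Summit.QuantumFields.BalabanUV.Beta.CompositeCorrectorLinear (corrPsi_apply corrPhi_apply)
open Summit.QuantumFields.BalabanUV.Beta.AxialDressingRooted (InHull mem_axial_hull mem_segUp_site)

noncomputable section

variable {d : ℕ}

/-! ## §1 «Reads only the bonds of `P`» -/

/-- [our object] The functional `f` of the field READS ONLY THE BONDS OF `P`: two fields that agree on every bond `(κ, y) ∈ P` have the same value of `f`. -/
structure DepOn (P : Set (Fin d × Site d)) (f : Form1 d ℝ → ℝ) : Prop where
  /-- fields agreeing on `P` have the same value -/
  eq : ∀ ⦃A B : Form1 d ℝ⦄, (∀ κ y, (κ, y) ∈ P → A κ y = B κ y) → f A = f B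

/-- [folklore] Enlarging the read set. -/
theorem DepOn.mono {P Q : Set (Fin d × Site d)} {f : Form1 d ℝ → ℝ} (h : DepOn P f) (hPQ : P ⊆ Q) : DepOn Q f :=
  ⟨fun _ _ hAB => h.eq fun κ y hp => hAB κ y (hPQ hp)⟩

/-- [folklore] Constants read nothing. -/
theorem depOn_const (P : Set (Fin d × Site d)) (c : ℝ) : DepOn P fun _ => c := ⟨fun _ _ _ => rfl⟩

/-- [folklore] Evaluation at a bond reads that bond. -/
theorem depOn_eval (κ : Fin d) (x : Site d) : DepOn {(κ, x)} fun A => A κ x := ⟨fun _ _ h => h κ x rfl⟩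

/-- [folklore] Sums. -/
theorem DepOn.add {P : Set (Fin d × Site d)} {f g : Form1 d ℝ → ℝ} (hf : DepOn P f) (hg : DepOn P g) : DepOn P fun A => f A + g A :=
  ⟨fun A B h => show f A + g A = f B + g B by rw [hf.eq h, hg.eq h]⟩

/-- [folklore] Differences. -/
theorem DepOn.sub {P : Set (Fin d × Site d)} {f g : Form1 d ℝ → ℝ} (hf : DepOn P f) (hg : DepOn P g) : DepOn P fun A => f A - g A :=
  ⟨fun A B h => show f A - g A = f B - g B by rw [hf.eq h, hg.eq h]⟩

/-- [folklore] Scalar multiples. -/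
theorem DepOn.mul_left {P : Set (Fin d × Site d)} {f : Form1 d ℝ → ℝ} (c : ℝ) (hf : DepOn P f) : DepOn P fun A => c * f A :=
  ⟨fun A B h => show c * f A = c * f B by rw [hf.eq h]⟩

/-- [folklore] Finite sums. -/
theorem depOn_sum {ι : Type*} {P : Set (Fin d × Site d)} (s : Finset ι) {F : ι → Form1 d ℝ → ℝ} (h : ∀ i ∈ s, DepOn P (F i)) :
    DepOn P fun A => ∑ i ∈ s, F i A :=
  ⟨fun _ _ hAB => Finset.sum_congr rfl fun i hi => (h i hi).eq hAB⟩

/-- [folklore] **COMPOSITION**: if `f` reads only the bonds `q ∈ Q` of its argument, and each such coordinate `q` of the operator `T` reads only the bonds of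
`PT q`, all contained in `P`, then `f ∘ T` reads only the bonds of `P`. -/
theorem DepOn.comp {P Q : Set (Fin d × Site d)} {PT : Fin d × Site d → Set (Fin d × Site d)} {T : Form1 d ℝ → Form1 d ℝ} {f : Form1 d ℝ → ℝ}
    (hf : DepOn Q f) (hT : ∀ q ∈ Q, DepOn (PT q) fun A => T A q.1 q.2) (hP : ∀ q ∈ Q, PT q ⊆ P) : DepOn P fun A => f (T A) := by
  refine ⟨fun A B hAB => hf.eq fun κ y hq => ?_⟩
  exact (hT (κ, y) hq).eq fun κ' y' hp => hAB κ' y' (hP _ hq hp)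

/-! ## §2 One level: blocks, the hull lemma, the tree integral and the rooted linear average -/

/-- [folklore] `N·(blk N y)_j ≤ y_j` (`0 < N`). -/
theorem le_of_blk {N : ℕ} (hN : 0 < N) (y : Site d) (j : Fin d) : (N : ℤ) * blk N y j ≤ y j := by
  have h1 := Int.emod_nonneg (y j) (show (N : ℤ) ≠ 0 by exact_mod_cast hN.ne')
  have e := Int.mul_ediv_add_emod (y j) (N : ℤ)
  show (N : ℤ) * (y j / (N : ℤ)) ≤ y j
  linarith

/-- [folklore] `y_j < N·(blk N y)_j + N` (`0 < N`). -/
theorem lt_of_blk {N : ℕ} (hN : 0 < N) (y : Site d) (j : Fin d) : y j < (N : ℤ) * blk N y j + N :=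
  Int.lt_mul_ediv_self_add (by exact_mod_cast hN)

/-- [folklore] The floor-division letter: `N·q ≤ y_j < N·q + N ⟹ (blk N y)_j = q`. -/
theorem blk_apply_eq_of_bounds {N : ℕ} (hN : 0 < N) {y : Site d} {j : Fin d} {q : ℤ} (h1 : (N : ℤ) * q ≤ y j)
    (h2 : y j < (N : ℤ) * q + N) : blk N y j = q := by
  have hN' : (N : ℤ) ≠ 0 := by exact_mod_cast hN.ne'
  show y j / (N : ℤ) = q
  have e : y j = (y j - (N : ℤ) * q) + (N : ℤ) * q := by ring
  rw [e, Int.add_mul_ediv_left _ _ hN', Int.ediv_eq_zero_of_lt (by linarith) (by linarith), zero_add]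

/-- [folklore] `blk 1 = id`. -/
theorem blk_one (y : Site d) : blk 1 y = y := by
  funext j
  show y j / ((1 : ℕ) : ℤ) = y j
  rw [Nat.cast_one, Int.ediv_one]

/-- [folklore] Nested blocks, outer order: `blk (L^(k+1)) y = blk L (blk (L^k) y)` (`0 < L`). -/
theorem blk_pow_succ' {L : ℕ} (hL : 0 < L) (k : ℕ) (y : Site d) : blk (L ^ (k + 1)) y = blk L (blk (L ^ k) y) := by
  funext j
  show y j / ((L ^ (k + 1) : ℕ) : ℤ) = y j / ((L ^ k : ℕ) : ℤ) / (L : ℤ)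
  push_cast
  rw [pow_succ, Int.ediv_ediv_of_nonneg (by positivity)]

/-- [folklore] `blk L` is monotone coordinatewise (`0 < L`). -/
theorem blk_apply_mono {L : ℕ} (hL : 0 < L) {u v : Site d} {j : Fin d} (h : u j ≤ v j) : blk L u j ≤ blk L v j :=
  Int.ediv_le_ediv (by exact_mod_cast hL) h

/-- [folklore] **THE HULL LEMMA** (in-block root): a point of the coordinatewise hull of the root `N•Y + r` (`r ∈ box`) and of a point `x` of the block `Y`
lies in the block `Y`. -/
theorem blk_eq_of_inHull {N : ℕ} (hN : 1 ≤ N) {Y : Site d} {r : Fin d → ℕ} (hr : r ∈ box d N) {x w : Site d} (hx : blk N x = Y)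
    (h : InHull ((N : ℤ) • Y + toSite r) x w) : blk N w = Y := by
  funext j
  have hrj : ((r j : ℕ) : ℤ) < N := by exact_mod_cast Finset.mem_range.1 (Fintype.mem_piFinset.1 hr j)
  have hr0 : (0 : ℤ) ≤ ((r j : ℕ) : ℤ) := by positivity
  have hx1 := le_of_blk hN x j
  have hx2 := lt_of_blk hN x j
  rw [hx] at hx1 hx2
  obtain ⟨h1, h2⟩ := h j
  simp only [Pi.add_apply, Pi.smul_apply, smul_eq_mul, toSite] at h1 h2
  exact blk_apply_eq_of_bounds hN (by omega) (by omega)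

/-- [our object] The set of bonds `(κ, y)` with BOTH endpoints `y`, `y + e_κ` in the `N`-block of coarse index `Y`. -/
def InBlockBond (N : ℕ) (Y : Site d) : Set (Fin d × Site d) := {p | blk N p.2 = Y ∧ blk N (p.2 + unitVec p.1) = Y}

/-- [our object] The set of sites `w` of the `N`-block PAIR `{z, z + e_μ}`: `z_j ≤ (blk N w)_j ≤ z_j + [j = μ]` for every `j`. -/
def InPair (N : ℕ) (μ : Fin d) (z : Site d) : Set (Site d) := {w | ∀ j, z j ≤ blk N w j ∧ blk N w j ≤ z j + if j = μ then 1 else 0}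

/-- [our object] The set of bonds `(κ, y)` with both endpoints in the `N`-block pair `{z, z + e_μ}`. -/
def InPairBond (N : ℕ) (μ : Fin d) (z : Site d) : Set (Fin d × Site d) := {p | p.2 ∈ InPair N μ z ∧ p.2 + unitVec p.1 ∈ InPair N μ z}

/-- [folklore] Membership in `InBlockBond`, unfolded. -/
theorem mem_inBlockBond {N : ℕ} {Y : Site d} {κ : Fin d} {y : Site d} :
    (κ, y) ∈ InBlockBond N Y ↔ blk N y = Y ∧ blk N (y + unitVec κ) = Y := Iff.rfl

/-- [folklore] A site of the block `z` is in the pair. -/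
theorem inPair_of_blk_eq {N : ℕ} {μ : Fin d} {z w : Site d} (h : blk N w = z) : w ∈ InPair N μ z := fun j => by
  rw [h]
  refine ⟨le_rfl, ?_⟩
  split_ifs <;> omega

/-- [folklore] A site of the block `z + e_μ` is in the pair. -/
theorem inPair_of_blk_eq_add {N : ℕ} {μ : Fin d} {z w : Site d} (h : blk N w = z + unitVec μ) : w ∈ InPair N μ z := fun j => by
  rw [h, Pi.add_apply, unitVec_apply]
  constructor <;> split_ifs <;> omega

/-- [folklore] The sites `N•z + b + s•e_μ`, `b ∈ box`, `s ≤ N`, of the straight segment and its endpoint are in the pair. -/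
theorem inPair_seg {N : ℕ} (hN : 1 ≤ N) {μ : Fin d} (z : Site d) {b : Fin d → ℕ} (hb : b ∈ box d N) {s : ℕ} (hs : s ≤ N) :
    (N : ℤ) • z + toSite b + (s : ℤ) • unitVec μ ∈ InPair N μ z := by
  intro j
  have hN' : (0 : ℤ) < N := by exact_mod_cast hN
  have hbj : ((b j : ℕ) : ℤ) < N := by exact_mod_cast Finset.mem_range.1 (Fintype.mem_piFinset.1 hb j)
  have hb0 : (0 : ℤ) ≤ ((b j : ℕ) : ℤ) := by positivity
  have hs' : (s : ℤ) ≤ N := by exact_mod_cast hs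
  have hs0 : (0 : ℤ) ≤ s := by positivity
  have ev : ((N : ℤ) • z + toSite b + (s : ℤ) • unitVec μ) j = (N : ℤ) * z j + (b j : ℕ) + (s : ℤ) * (if j = μ then 1 else 0) := by
    simp only [Pi.add_apply, Pi.smul_apply, smul_eq_mul, toSite, unitVec_apply]
  by_cases hj : j = μ
  · rw [if_pos hj]
    rw [if_pos hj, mul_one] at ev
    constructor
    · refine Int.le_ediv_of_mul_le hN' ?_
      rw [ev]; linarith
    · have : blk N ((N : ℤ) • z + toSite b + (s : ℤ) • unitVec μ) j < z j + 2 := by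
        refine Int.ediv_lt_of_lt_mul hN' ?_
        rw [ev]; linarith
      omega
  · rw [if_neg hj, add_zero]
    rw [if_neg hj, mul_zero, add_zero] at ev
    have e : blk N ((N : ℤ) • z + toSite b + (s : ℤ) • unitVec μ) j = z j :=
      blk_apply_eq_of_bounds hN (by rw [ev]; linarith) (by rw [ev]; linarith)
    rw [e]
    exact ⟨le_rfl, le_rfl⟩

/-- [folklore] **THE ROOTED TREE INTEGRAL AT `x` READS ONLY BONDS WITH BOTH ENDPOINTS IN THE `N`-BLOCK OF `x`** (in-block root: the axial contour from
the root of the block of `x` to `x` never leaves the block — an2's `mem_axial_hull`). -/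
theorem depOn_treeGaugeAt {N : ℕ} (hN : 1 ≤ N) {r : Fin d → ℕ} (hr : r ∈ box d N) (x : Site d) :
    DepOn (InBlockBond N (blk N x)) fun B => treeGaugeAt (toSite r) B N x := by
  refine ⟨fun A B hAB => ?_⟩
  have e := congrFun (treeGaugeAt_sub (toSite r) A B N) x
  rw [Pi.sub_apply] at e
  show treeGaugeAt (toSite r) A N x = treeGaugeAt (toSite r) B N x
  rw [← sub_eq_zero, ← e]
  show (axial (A - B) ((N : ℤ) • blk N x + toSite r) x).sum = 0
  refine List.sum_eq_zero fun a ha => ?_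
  obtain ⟨κ, z, e, hz, hz'⟩ := mem_axial_hull ha
  have h0 : (A - B) κ z = 0 := by
    rw [Pi.sub_apply, Pi.sub_apply, sub_eq_zero]
    exact hAB κ z ⟨blk_eq_of_inHull hN hr rfl hz, blk_eq_of_inHull hN hr rfl hz'⟩
  rcases e with e | e
  · rw [e, h0]
  · rw [e, h0, neg_zero]

/-- [folklore] Letters of a reversed contour are negated letters of the contour. -/
theorem mem_rev {R : Type*} [AddCommGroup R] {l : List R} {a : R} (h : a ∈ rev l) : ∃ a' ∈ l, a = -a' := by
  unfold AveragingContours.rev at h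
  rw [List.mem_reverse, List.mem_map] at h
  obtain ⟨a', ha', rfl⟩ := h
  exact ⟨a', ha', rfl⟩

/-- [folklore] **THE ROOTED LINEAR AVERAGE AT THE COARSE BOND `(μ, z)` READS ONLY BONDS WITH BOTH ENDPOINTS IN THE BLOCK PAIR `{z, z + e_μ}`** (in-block
root): the axial contour in the block `z`, the straight segment of `N` bonds, the reversed axial contour in the block `z + e_μ`. -/
theorem depOn_linAvgAt {N : ℕ} (hN : 1 ≤ N) {r : Fin d → ℕ} (hr : r ∈ box d N) (μ : Fin d) (z : Site d) :
    DepOn (InPairBond N μ z) fun B => linAvgAt (toSite r) B N μ z := by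
  refine ⟨fun A B hAB => ?_⟩
  show linAvgAt (toSite r) A N μ z = linAvgAt (toSite r) B N μ z
  rw [← sub_eq_zero, ← linAvgAt_sub]
  have key : ∀ (κ : Fin d) (w : Site d), w ∈ InPair N μ z → w + unitVec κ ∈ InPair N μ z → (A - B) κ w = 0 := fun κ w h1 h2 => by
    rw [Pi.sub_apply, Pi.sub_apply, sub_eq_zero]
    exact hAB κ w ⟨h1, h2⟩
  refine Finset.sum_eq_zero fun b hb => List.sum_eq_zero fun a ha => ?_
  simp only [gammaCAt, List.mem_append] at ha
  rcases ha with (ha | ha) | ha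
  · -- the axial contour in the block `z`
    obtain ⟨κ, w, e, hw, hw'⟩ := mem_axial_hull ha
    have hbz : blk N ((N : ℤ) • z + toSite b) = z := blk_block z hb
    have h0 := key κ w (inPair_of_blk_eq (blk_eq_of_inHull hN hr hbz hw)) (inPair_of_blk_eq (blk_eq_of_inHull hN hr hbz hw'))
    rcases e with e | e
    · rw [e, h0]
    · rw [e, h0, neg_zero]
  · -- the straight segment
    obtain ⟨s, hs, e⟩ := mem_segUp_site ha
    have e2 : (N : ℤ) • z + toSite b + (s : ℤ) • unitVec μ + unitVec μ = (N : ℤ) • z + toSite b + ((s + 1 : ℕ) : ℤ) • unitVec μ := by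
      rw [Nat.cast_succ, add_smul, one_smul, add_assoc]
    have h0 := key μ _ (inPair_seg hN z hb hs.le) (by rw [e2]; exact inPair_seg hN z hb (Nat.succ_le_of_lt hs))
    rw [e, h0]
  · -- the reversed axial contour in the block `z + e_μ`
    obtain ⟨a', ha', rfl⟩ := mem_rev ha
    obtain ⟨κ, w, e, hw, hw'⟩ := mem_axial_hull ha'
    have e1 : (N : ℤ) • z + toSite r + (N : ℤ) • unitVec μ = (N : ℤ) • (z + unitVec μ) + toSite r := by rw [smul_add]; abel
    have e2 : (N : ℤ) • z + toSite b + (N : ℤ) • unitVec μ = (N : ℤ) • (z + unitVec μ) + toSite b := by rw [smul_add]; abel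
    rw [e1, e2] at hw hw'
    have hbz : blk N ((N : ℤ) • (z + unitVec μ) + toSite b) = z + unitVec μ := blk_block _ hb
    have h0 := key κ w (inPair_of_blk_eq_add (blk_eq_of_inHull hN hr hbz hw)) (inPair_of_blk_eq_add (blk_eq_of_inHull hN hr hbz hw'))
    rcases e with e | e
    · rw [e, h0, neg_zero]
    · rw [e, h0, neg_zero, neg_zero]

/-! ## §3 All levels: the composite average, the defect potential, the correctors -/

/-- [folklore] **ONE LEVEL UP FOR PAIRS**: if `blk (L^k) y` lies between `z′` and `z′ + e_κ′` coordinatewise and both `z′`, `z′ + e_κ′` lie in the `L`-block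
pair of `z`, then `y` lies in the `L^(k+1)`-block pair of `z` (nested blocks + monotonicity of `blk L`). -/
theorem inPair_pow_succ {L : ℕ} (hL : 0 < L) {k : ℕ} {μ κ' : Fin d} {z z' y : Site d} (hy : y ∈ InPair (L ^ k) κ' z')
    (h1 : z' ∈ InPair L μ z) (h2 : z' + unitVec κ' ∈ InPair L μ z) : y ∈ InPair (L ^ (k + 1)) μ z := by
  intro j
  rw [blk_pow_succ' hL]
  have m1 : blk L z' j ≤ blk L (blk (L ^ k) y) j := blk_apply_mono hL (hy j).1
  have m2 : blk L (blk (L ^ k) y) j ≤ blk L (z' + unitVec κ') j :=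
    blk_apply_mono hL (by rw [Pi.add_apply, unitVec_apply]; exact (hy j).2)
  exact ⟨(h1 j).1.trans m1, m2.trans (h2 j).2⟩

/-- [folklore] **ONE LEVEL UP FOR BLOCKS**: if `blk (L^k) y` lies between `z′` and `z′ + e_κ′` and both lie in the `L`-block `Y`, then `y` lies in the
`L^(k+1)`-block `Y`. -/
theorem blk_pow_succ_eq_of_inPair {L : ℕ} (hL : 0 < L) {k : ℕ} {κ' : Fin d} {Y z' y : Site d} (hy : y ∈ InPair (L ^ k) κ' z')
    (h1 : blk L z' = Y) (h2 : blk L (z' + unitVec κ') = Y) : blk (L ^ (k + 1)) y = Y := by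
  funext j
  rw [blk_pow_succ' hL]
  have m1 : blk L z' j ≤ blk L (blk (L ^ k) y) j := blk_apply_mono hL (hy j).1
  have m2 : blk L (blk (L ^ k) y) j ≤ blk L (z' + unitVec κ') j :=
    blk_apply_mono hL (by rw [Pi.add_apply, unitVec_apply]; exact (hy j).2)
  rw [h1] at m1
  rw [h2] at m2
  exact le_antisymm m2 m1

/-- [folklore] **THE LEVEL-`k` COMPOSITE AVERAGE AT THE BOND `(κ, z)` READS ONLY FINE BONDS WITH BOTH ENDPOINTS IN THE `L^k`-BLOCK PAIR `{z, z + e_κ}`**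
(in-block roots; induction on `k` by `compLinAvgAt_succ`, one level = `depOn_linAvgAt`, composition = `inPair_pow_succ`). -/
theorem depOn_compLinAvgAt {L : ℕ} (hL : 0 < L) (r : ℕ → (Fin d → ℕ)) (hr : ∀ k, r k ∈ box d L) :
    ∀ (k : ℕ) (κ : Fin d) (z : Site d), DepOn (InPairBond (L ^ k) κ z) fun A => compLinAvgAt r L k A κ z
  | 0, κ, z => by
      refine ⟨fun A B hAB => ?_⟩
      show A κ z = B κ z
      apply hAB
      have h0 : ∀ w : Site d, blk (L ^ 0) w = w := fun w => by rw [pow_zero, blk_one]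
      exact ⟨inPair_of_blk_eq (h0 z), inPair_of_blk_eq_add (h0 _)⟩
  | k + 1, κ, z => by
      show DepOn _ fun A => linAvgAt (toSite (r k)) (compLinAvgAt r L k A) L κ z
      refine DepOn.comp (T := fun A => compLinAvgAt r L k A) (PT := fun q => InPairBond (L ^ k) q.1 q.2) (depOn_linAvgAt hL (hr k) κ z)
        (fun q _ => depOn_compLinAvgAt hL r hr k q.1 q.2) ?_
      rintro ⟨κ', z'⟩ ⟨h1, h2⟩ ⟨κ'', y⟩ ⟨hy1, hy2⟩
      exact ⟨inPair_pow_succ hL hy1 h1 h2, inPair_pow_succ hL hy2 h1 h2⟩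

/-- [folklore] **THE DEFECT POTENTIAL `ζ_m A Y` READS ONLY FINE BONDS WITH BOTH ENDPOINTS IN THE `L^m`-BLOCK `Y`** (in-block roots; induction on `m` by
`compDefectAt_succ`: the block sum of `ζ_{m}` over the `L`-block of `Y`, and the rooted tree integrals of the level-`m` composite inside that block). -/
theorem depOn_compDefectAt {L : ℕ} (hL : 0 < L) (r : ℕ → (Fin d → ℕ)) (hr : ∀ k, r k ∈ box d L) :
    ∀ (m : ℕ) (Y : Site d), DepOn (InBlockBond (L ^ m) Y) fun A => compDefectAt r L m A Y
  | 0, _ => ⟨fun _ _ _ => rfl⟩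
  | m + 1, Y => by
      show DepOn _ fun A => blockSum L (compDefectAt r L m A + treeGaugeAt (toSite (r m)) (compLinAvgAt r L m A) L) Y
      simp only [blockSum, Pi.add_apply]
      refine depOn_sum _ fun b hb => DepOn.add ?_ ?_
      · refine (depOn_compDefectAt hL r hr m _).mono ?_
        rintro ⟨κ, y⟩ ⟨hy1, hy2⟩
        refine ⟨?_, ?_⟩
        · rw [blk_pow_succ' hL, hy1, blk_block Y hb]
        · rw [blk_pow_succ' hL, hy2, blk_block Y hb]
      · refine DepOn.comp (T := fun A => compLinAvgAt r L m A) (PT := fun q => InPairBond (L ^ m) q.1 q.2)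
          (depOn_treeGaugeAt hL (hr m) _) (fun q _ => depOn_compLinAvgAt hL r hr m q.1 q.2) ?_
        rintro ⟨κ', z'⟩ ⟨h1, h2⟩ ⟨κ'', y⟩ ⟨hy1, hy2⟩
        rw [blk_block Y hb] at h1 h2
        exact ⟨blk_pow_succ_eq_of_inPair hL hy1 h1 h2, blk_pow_succ_eq_of_inPair hL hy2 h1 h2⟩

/-- [our object] THE SET OF BONDS READ BY `(Ψ_m A)_α(x)` AND BY `(Φ_m A)_α(x)` at scale `n`: the bond `(α, x)` itself, and the bonds with both endpoints in the
`n`-block of `x` or in the `n`-block of `x + e_α` (the two coincide unless `(α, x)` crosses a block face). -/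
def CorrReads (n : ℕ) (α : Fin d) (x : Site d) : Set (Fin d × Site d) :=
  {p | p = (α, x) ∨ p ∈ InBlockBond n (blk n x) ∨ p ∈ InBlockBond n (blk n (x + unitVec α))}

/-- [folklore] Membership in `CorrReads`, unfolded. -/
theorem mem_corrReads {n : ℕ} {α : Fin d} {x : Site d} {p : Fin d × Site d} :
    p ∈ CorrReads n α x ↔ p = (α, x) ∨ p ∈ InBlockBond n (blk n x) ∨ p ∈ InBlockBond n (blk n (x + unitVec α)) := Iff.rfl

/-- [folklore] **`(Ψ_m A)_α(x)` READS ONLY THE BONDS OF `CorrReads (L^m) α x`.** -/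
theorem depOn_corrPsi {L : ℕ} (hL : 0 < L) (r : ℕ → (Fin d → ℕ)) (hr : ∀ k, r k ∈ box d L) (m : ℕ) (α : Fin d) (x : Site d) :
    DepOn (CorrReads (L ^ m) α x) fun A => corrPsi r L m A α x := by
  simp only [corrPsi_apply]
  refine DepOn.add ((depOn_eval α x).mono fun p hp => Or.inl hp) (DepOn.mul_left _ (DepOn.sub ?_ ?_))
  · exact (depOn_compDefectAt hL r hr m _).mono fun p hp => Or.inr (Or.inr hp)
  · exact (depOn_compDefectAt hL r hr m _).mono fun p hp => Or.inr (Or.inl hp)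

/-- [folklore] **`(Φ_m A)_α(x)` READS ONLY THE BONDS OF `CorrReads (L^m) α x`.** -/
theorem depOn_corrPhi {L : ℕ} (hL : 0 < L) (r : ℕ → (Fin d → ℕ)) (hr : ∀ k, r k ∈ box d L) (m : ℕ) (α : Fin d) (x : Site d) :
    DepOn (CorrReads (L ^ m) α x) fun A => corrPhi r L m A α x := by
  simp only [corrPhi_apply]
  refine DepOn.sub ((depOn_eval α x).mono fun p hp => Or.inl hp) (DepOn.mul_left _ (DepOn.sub ?_ ?_))
  · exact (depOn_compDefectAt hL r hr m _).mono fun p hp => Or.inr (Or.inr hp)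
  · exact (depOn_compDefectAt hL r hr m _).mono fun p hp => Or.inr (Or.inl hp)

/-! ## §4 The read set inside a `Finset` -/

/-- [our object] THE `n`-BLOCK OF COARSE INDEX `Y` AS A `Finset` OF SITES: `Π_j [n·Y_j, n·Y_j + n − 1]`. -/
def blockSitesF (n : ℕ) (Y : Site d) : Finset (Site d) :=
  Fintype.piFinset fun j => Finset.Icc ((n : ℤ) * Y j) ((n : ℤ) * Y j + n - 1)

/-- [folklore] A site of the block `Y` belongs to `blockSitesF n Y` (`0 < n`). -/
theorem mem_blockSitesF_of_blk_eq {n : ℕ} (hn : 0 < n) {Y y : Site d} (h : blk n y = Y) : y ∈ blockSitesF n Y := by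
  rw [blockSitesF, Fintype.mem_piFinset]
  intro j
  rw [Finset.mem_Icc]
  have h1 := le_of_blk hn y j
  have h2 := lt_of_blk hn y j
  rw [h] at h1 h2
  constructor <;> omega

/-- [our object] A `Finset` OF BONDS CONTAINING THE READ SET `CorrReads n α x`: the bond `(α, x)` and every bond based in the `n`-block of `x` or of `x + e_α`. -/
def corrDep (n : ℕ) (α : Fin d) (x : Site d) : Finset (Fin d × Site d) :=
  insert (α, x) (Finset.univ ×ˢ (blockSitesF n (blk n x) ∪ blockSitesF n (blk n (x + unitVec α))))

/-- [folklore] `CorrReads n α x ⊆ corrDep n α x` (`0 < n`). -/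
theorem mem_corrDep_of_mem_corrReads {n : ℕ} (hn : 0 < n) {α : Fin d} {x : Site d} {p : Fin d × Site d}
    (h : p ∈ CorrReads n α x) : p ∈ corrDep n α x := by
  rw [corrDep, Finset.mem_insert]
  rcases h with h | h | h
  · exact Or.inl h
  · exact Or.inr (Finset.mem_product.2 ⟨Finset.mem_univ _, Finset.mem_union_left _ (mem_blockSitesF_of_blk_eq hn h.1)⟩)
  · exact Or.inr (Finset.mem_product.2 ⟨Finset.mem_univ _, Finset.mem_union_right _ (mem_blockSitesF_of_blk_eq hn h.1)⟩)

end

end Summit.QuantumFields.BalabanUV.Beta.CompositeCorrectorLocality
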